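import Literature.NumberTheory.Automorphic.ArchimedeanCharacterTwist
import HarnessLib

/-!
# The archimedean calculus of a pull-back `φ ∘ r` along a map intertwining the one-parameter
# subgroups: `r(g · exp X) = r(g) · exp(L X)`

Topic `NumberTheory/Automorphic`; namespace `Literature.NumberTheory.Automorphic`. Generic calculus for
the archimedean variable (`ArchimedeanCalculus`: `H : RealMatrixGroup A N`, `ι : H → G`, Lie
derivatives `lieDeriv`, the word action `applyFree`, central words `IsCentralWord`, the `Z(𝔤)`-orbit
span `zOrbitSpan`, `K`-finiteness). Let `r : G → G` and a real linear `L : 𝔤 → 𝔤` satisfy the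
**intertwining identity** `r(g · ι(exp X)) = r(g) · ι(exp (L X))` for all `g`, `X`. We PROVE:

* `IsArchSmooth.comp_of_intertwine`, `lieDeriv_comp_of_intertwine`,
  `iterLieDeriv_comp_of_intertwine` — `φ ∘ r` is smooth if `φ` is, and
  `X (φ ∘ r) = ((L X) φ) ∘ r`, word by word;
* `applyFree_comp_of_intertwine` — **`p (φ ∘ r) = ((σ_L p) φ) ∘ r`** for every `p ∈ ℝ⟨𝔤⟩` and
  smooth `φ`, where `σ_L` substitutes `L X` for every letter `X` (`FreeAlgebra.lift`);
* `isCentralWord_lift_of_sub_smul` — if `L X = X - f(X) · Z` with `Z` central in `𝔤` and `f`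
  killing brackets (so `L` is a Lie algebra endomorphism of `𝔤`, typically the projection onto an
  ideal complementary to the line `ℝ Z`), then **`σ_L` maps central words to central words**:
  `σ_L` covers the algebra endomorphism `σ` of `U(𝔤)` lifting `L`; for `z ∈ Z(𝔤)`, `σ z` commutes
  with `σ(𝔤) = L(𝔤)` and with the central element `Z`, and `𝔤 = L(𝔤) + ℝ Z` generates `U(𝔤)`
  (`mem_center_of_forall_ι_comm` of `RealCasimirGL`);
* `IsZFinite.comp_of_intertwine`, `IsKFinite.comp_of_intertwine` — hence **`φ ∘ r` is
  `Z(𝔤)`-finite (resp. `K`-finite) if `φ` is** (for `K`-finiteness: `r` commuting with `K`).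

This is the infinitesimal bookkeeping behind "restrict an automorphic form to `G(𝔸)¹` and extend it
trivially across the split component `A_G`" (Moeglin–Waldspurger (1995), I.2.3 and I.3.2: automorphic
forms on `G(𝔸)` versus `A_G \ G(𝔸)`; Borel–Jacquet (1979), 4.2 and 5.7), used to reduce statements
about arbitrary cusp forms to `A_G`-invariant ones. Everything here is proved; no definitions.

## References

* C. Moeglin, J.-L. Waldspurger, *Spectral decomposition and Eisenstein series* (1995), I.2.3, I.3.2
  [MoeglinWaldspurger1995].
* A. Borel, H. Jacquet, *Automorphic forms and automorphic representations*, Proc. Sympos. Pure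
  Math. 33 (1979), part 1, §1.5–1.6, 4.2, 5.7 [BorelJacquet1979].
* J. Dixmier, *Enveloping Algebras* (1977/1996), 2.1.1, 2.2.
-/

noncomputable section

-- Mathlib idiom (Mathlib/Algebra/Lie/OfAssociative.lean); needed for `U(𝔤)` as a Lie algebra (`UniversalEnvelopingAlgebra.ι`)
attribute [local instance 100] LieRing.ofAssociativeRing

open scoped MatrixGroups Matrix ContDiff

namespace Literature.NumberTheory.Automorphic

variable {A : Type*} [NormedCommRing A] [NormedAlgebra ℝ A] [NormedAlgebra ℚ A] [CompleteSpace A]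
  [StarRing A] {N : Type*} [Fintype N] [DecidableEq N] {H : RealMatrixGroup A N}
  {G : Type*} [Group G] (ι : H.carrier →* G)

/-! ### Central elements of `𝔤` are central in `U(𝔤)` -/

section Center

/-- **The image in `U(𝔤)` of a central element of `𝔤` is central.** [folklore] -/
theorem ι_mem_center_of_forall_lie_eq_zero {Z : H.lie} (hZ : ∀ Y : H.lie, ⁅Z, Y⁆ = 0) :
    UniversalEnvelopingAlgebra.ι ℝ Z ∈ Subalgebra.center ℝ (UniversalEnvelopingAlgebra ℝ H.lie) := by
  refine mem_center_of_forall_ι_comm fun Y => ?_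
  have h1 : ⁅UniversalEnvelopingAlgebra.ι ℝ Z, UniversalEnvelopingAlgebra.ι ℝ Y⁆ =
      (0 : UniversalEnvelopingAlgebra ℝ H.lie) := by
    rw [← LieHom.map_lie, hZ Y, map_zero]
  rw [LieRing.of_associative_ring_bracket, sub_eq_zero] at h1
  exact h1.symm

end Center

/-! ### Pull-back along a map intertwining the one-parameter subgroups -/

section Pullback

variable {r : G → G} {L : H.lie →ₗ[ℝ] H.lie}

set_option backward.isDefEq.respectTransparency false in
open scoped Matrix.Norms.Operator in
/-- **`φ ∘ r` is smooth in the archimedean variable if `φ` is**, when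
`r(g ι(exp X)) = r(g) ι(exp(L X))` (`X ↦ φ(r(g) ι(exp (L X)))` is a smooth function of `L X`).
[cite: MoeglinWaldspurger1995, I.2.3] -/
theorem IsArchSmooth.comp_of_intertwine [FiniteDimensional ℝ A]
    (hr : ∀ (g : G) (X : H.lie), r (g * ι (H.expMem X)) = r g * ι (H.expMem (L X)))
    {φ : G → ℂ} (hφ : IsArchSmooth ι φ) : IsArchSmooth ι (φ ∘ r) := by
  -- Mathlib idiom (Mathlib/Algebra/Lie/OfAssociative.lean), needed to name `𝔤.toSubmodule`
  letI : LieRing (Matrix N N A) := LieRing.ofAssociativeRing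
  intro g
  -- `L` on the underlying submodule, as a continuous linear map
  let Lc : H.lie.toSubmodule →ₗ[ℝ] H.lie.toSubmodule :=
    { toFun := fun X => ⟨(L ⟨X, X.2⟩ : Matrix N N A), (L ⟨X, X.2⟩).2⟩
      map_add' := fun X Y => by
        refine Subtype.ext ?_
        change ((L (⟨X, X.2⟩ + ⟨Y, Y.2⟩) : H.lie) : Matrix N N A) = (L ⟨X, X.2⟩ : Matrix N N A) + (L ⟨Y, Y.2⟩ : Matrix N N A)
        rw [map_add]; rfl
      map_smul' := fun c X => by
        refine Subtype.ext ?_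
        change ((L (c • ⟨X, X.2⟩) : H.lie) : Matrix N N A) = c • (L ⟨X, X.2⟩ : Matrix N N A)
        rw [map_smul]; rfl }
  have hLc : Continuous Lc := Lc.continuous_of_finiteDimensional
  have hcomp : (fun X : H.lie.toSubmodule => (φ ∘ r) (g * ι (H.expMem ⟨X, X.2⟩))) =
      (fun Y : H.lie.toSubmodule => φ (r g * ι (H.expMem ⟨Y, Y.2⟩))) ∘ Lc := by
    funext X
    simp only [Function.comp_apply]
    rw [hr]
    rfl
  rw [hcomp]
  exact (hφ (r g)).comp (⟨Lc, hLc⟩ : H.lie.toSubmodule →L[ℝ] H.lie.toSubmodule).contDiff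

/-- **`X (φ ∘ r) = ((L X) φ) ∘ r`** (the flows correspond under `r`). [cite: MoeglinWaldspurger1995, I.2.3] -/
theorem lieDeriv_comp_of_intertwine
    (hr : ∀ (g : G) (X : H.lie), r (g * ι (H.expMem X)) = r g * ι (H.expMem (L X)))
    (X : H.lie) (φ : G → ℂ) (g : G) :
    lieDeriv ι X (φ ∘ r) g = lieDeriv ι (L X) φ (r g) := by
  unfold lieDeriv
  congr 1
  funext t
  rw [Function.comp_apply, hr, map_smul]

/-- **Iterated Lie derivatives of `φ ∘ r`**: `(X₁ ⋯ X_k)(φ ∘ r) = ((L X₁) ⋯ (L X_k) φ) ∘ r`.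
[cite: MoeglinWaldspurger1995, I.2.3] -/
theorem iterLieDeriv_comp_of_intertwine
    (hr : ∀ (g : G) (X : H.lie), r (g * ι (H.expMem X)) = r g * ι (H.expMem (L X)))
    (φ : G → ℂ) : ∀ w : List H.lie, iterLieDeriv ι w (φ ∘ r) = iterLieDeriv ι (w.map L) φ ∘ r
  | [] => rfl
  | X :: w => by
    rw [iterLieDeriv_cons, List.map_cons, iterLieDeriv_cons, iterLieDeriv_comp_of_intertwine hr φ w]
    funext g
    exact lieDeriv_comp_of_intertwine ι hr X _ g

/-- **The word action on `φ ∘ r`**: `p (φ ∘ r) = ((σ_L p) φ) ∘ r` for every `p ∈ ℝ⟨𝔤⟩` and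
smooth `φ`, `σ_L = FreeAlgebra.lift (X ↦ L X)` the substitution of `L X` for the letter `X`
(induction on `p`; products through `(p q) ψ = p (q ψ)` on smooth `ψ`). [cite: MoeglinWaldspurger1995, I.2.3] -/
theorem applyFree_comp_of_intertwine [FiniteDimensional ℝ A]
    (hr : ∀ (g : G) (X : H.lie), r (g * ι (H.expMem X)) = r g * ι (H.expMem (L X)))
    (p : FreeAlgebra ℝ H.lie) {φ : G → ℂ} (hφ : IsArchSmooth ι φ) :
    applyFree ι p (φ ∘ r) =
      applyFree ι (FreeAlgebra.lift ℝ (fun X => FreeAlgebra.ι ℝ (L X)) p) φ ∘ r := by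
  induction p using FreeAlgebra.induction generalizing φ with
  | grade0 c =>
    rw [AlgHom.commutes, applyFree_algebraMap, applyFree_algebraMap]
    rfl
  | grade1 X =>
    rw [FreeAlgebra.lift_ι_apply, applyFree_ι_eq_lieDeriv, applyFree_ι_eq_lieDeriv]
    funext g
    exact lieDeriv_comp_of_intertwine ι hr X φ g
  | mul p q hp hq =>
    have hφr : IsArchSmooth ι (φ ∘ r) := hφ.comp_of_intertwine ι hr
    have hσq : IsArchSmooth ι (applyFree ι (FreeAlgebra.lift ℝ (fun X => FreeAlgebra.ι ℝ (L X)) q) φ) :=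
      isArchSmooth_applyFree_of_isArchSmooth _ hφ
    rw [applyFree_mul_apply_of_isArchSmooth ι _ _ hφr, hq hφ, hp hσq, map_mul,
      applyFree_mul_apply_of_isArchSmooth ι _ _ hφ]
  | add p q hp hq =>
    rw [applyFree_add, hp hφ, hq hφ, map_add, applyFree_add]
    rfl

end Pullback

/-! ### The substitution `X ↦ X - f(X) Z` preserves central words -/

section Central

/-- **The substitution `X ↦ L X = X - f(X) · Z` maps central words to central words**, for `Z`
central in `𝔤` and `f : 𝔤 → ℝ` linear vanishing on brackets. Then `L` is a Lie algebra
endomorphism of `𝔤` (the bracket of `𝔤` lands where `f` vanishes), so the substitution `σ_L` on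
`ℝ⟨𝔤⟩` covers the algebra endomorphism `σ` of `U(𝔤)` lifting `L`; for `z ∈ Z(𝔤)`, `σ z` commutes
with `σ(ι X) = ι(L X)` and with the central `ι Z`, hence with `ι X = ι(L X) + f(X) ι Z` for every
`X`, hence is central (`mem_center_of_forall_ι_comm`). Dixmier 2.2 (functoriality of `U`).
[folklore] -/
theorem isCentralWord_lift_of_sub_smul {L : H.lie →ₗ[ℝ] H.lie} {Z : H.lie} {f : H.lie →ₗ[ℝ] ℝ}
    (hZ : ∀ Y : H.lie, ⁅Z, Y⁆ = 0) (hf : ∀ X Y : H.lie, f ⁅X, Y⁆ = 0) (hL : ∀ X, L X = X - f X • Z)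
    {p : FreeAlgebra ℝ H.lie} (hp : IsCentralWord p) :
    IsCentralWord (FreeAlgebra.lift ℝ (fun X => FreeAlgebra.ι ℝ (L X)) p) := by
  -- `L` as a Lie algebra endomorphism
  have hZ' : ∀ Y : H.lie, ⁅Y, Z⁆ = 0 := fun Y => by rw [← lie_skew, hZ Y, neg_zero]
  let L' : H.lie →ₗ⁅ℝ⁆ H.lie :=
    { toLinearMap := L
      map_lie' := by
        intro X Y
        change L ⁅X, Y⁆ = ⁅L X, L Y⁆
        rw [hL, hL X, hL Y, hf, zero_smul, sub_zero]
        simp only [sub_lie, lie_sub, smul_lie, lie_smul, hZ, hZ', smul_zero, sub_zero] }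
  have hL' : ∀ X, L' X = L X := fun X => rfl
  -- its lift `σ` to `U(𝔤)` and the substitution `σ_L` covering it
  set σ : UniversalEnvelopingAlgebra ℝ H.lie →ₐ[ℝ] UniversalEnvelopingAlgebra ℝ H.lie :=
    UniversalEnvelopingAlgebra.lift ℝ ((UniversalEnvelopingAlgebra.ι ℝ).comp L') with hσ
  have hσι : ∀ X : H.lie, σ (UniversalEnvelopingAlgebra.ι ℝ X) = UniversalEnvelopingAlgebra.ι ℝ (L X) := fun X => by
    rw [hσ, UniversalEnvelopingAlgebra.lift_ι_apply]; rfl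
  have hsub : (freeToEnveloping H).comp (FreeAlgebra.lift ℝ (fun X => FreeAlgebra.ι ℝ (L X))) =
      σ.comp (freeToEnveloping H) := by
    refine FreeAlgebra.hom_ext (funext fun X => ?_)
    simp only [Function.comp_apply, AlgHom.comp_apply, FreeAlgebra.lift_ι_apply, freeToEnveloping_ι]
    rw [hσι]
  have key : freeToEnveloping H (FreeAlgebra.lift ℝ (fun X => FreeAlgebra.ι ℝ (L X)) p) =
      σ (freeToEnveloping H p) := by
    have := congrArg (fun F => F p) hsub
    simpa only [AlgHom.comp_apply] using this
  -- `ι Z` is central in `U(𝔤)`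
  have hιZ := ι_mem_center_of_forall_lie_eq_zero (H := H) hZ
  -- `σ z` is central
  unfold IsCentralWord at hp ⊢
  rw [key]
  refine mem_center_of_forall_ι_comm fun Y => ?_
  have hY : UniversalEnvelopingAlgebra.ι ℝ Y = σ (UniversalEnvelopingAlgebra.ι ℝ Y) +
      f Y • UniversalEnvelopingAlgebra.ι ℝ Z := by
    rw [hσι, hL, map_sub, map_smul, sub_add_cancel]
  have h1 : σ (UniversalEnvelopingAlgebra.ι ℝ Y) * σ (freeToEnveloping H p) =
      σ (freeToEnveloping H p) * σ (UniversalEnvelopingAlgebra.ι ℝ Y) := by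
    rw [← map_mul, ← map_mul, (Subalgebra.mem_center_iff.1 hp) (UniversalEnvelopingAlgebra.ι ℝ Y)]
  have h2 : UniversalEnvelopingAlgebra.ι ℝ Z * σ (freeToEnveloping H p) =
      σ (freeToEnveloping H p) * UniversalEnvelopingAlgebra.ι ℝ Z :=
    ((Subalgebra.mem_center_iff.1 hιZ) (σ (freeToEnveloping H p))).symm
  rw [hY, add_mul, mul_add, smul_mul_assoc, mul_smul_comm, h1, h2]

end Central

/-! ### `Z(𝔤)`-finiteness and `K`-finiteness of the pull-back -/

section Finite

variable {r : G → G} {L : H.lie →ₗ[ℝ] H.lie}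

/-- **`φ ∘ r` is `Z(𝔤)`-finite if `φ` is** (smooth `φ`; `r` intertwining with `L X = X - f(X) Z` as in
`isCentralWord_lift_of_sub_smul`): the `Z(𝔤)`-orbit of `φ ∘ r` consists of pull-backs of elements
of the `Z(𝔤)`-orbit span of `φ` (`applyFree_comp_of_intertwine`). [cite: MoeglinWaldspurger1995, I.2.3] -/
theorem IsZFinite.comp_of_intertwine [FiniteDimensional ℝ A]
    (hr : ∀ (g : G) (X : H.lie), r (g * ι (H.expMem X)) = r g * ι (H.expMem (L X)))
    {Z : H.lie} {f : H.lie →ₗ[ℝ] ℝ} (hZ : ∀ Y : H.lie, ⁅Z, Y⁆ = 0) (hf : ∀ X Y : H.lie, f ⁅X, Y⁆ = 0)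
    (hL : ∀ X, L X = X - f X • Z) {φ : G → ℂ} (hφ : IsArchSmooth ι φ) (hz : IsZFinite ι φ) :
    IsZFinite ι (φ ∘ r) := by
  unfold IsZFinite at hz ⊢
  have hle : zOrbitSpan ι (φ ∘ r) ≤ (zOrbitSpan ι φ).map (LinearMap.funLeft ℂ ℂ r) := by
    refine Submodule.span_le.2 ?_
    rintro _ ⟨p, hp, rfl⟩
    refine ⟨applyFree ι (FreeAlgebra.lift ℝ (fun X => FreeAlgebra.ι ℝ (L X)) p) φ,
      Submodule.subset_span ⟨_, isCentralWord_lift_of_sub_smul hZ hf hL hp, rfl⟩, ?_⟩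
    rw [applyFree_comp_of_intertwine ι hr p hφ]
    rfl
  haveI : FiniteDimensional ℂ ((zOrbitSpan ι φ).map (LinearMap.funLeft ℂ ℂ r)) := inferInstance
  exact Submodule.finiteDimensional_of_le hle

/-- **`φ ∘ r` is `K`-finite if `φ` is**, when `r` commutes with right translation by `K`:
`r(g ι(k)) = r(g) ι(k)`. [cite: MoeglinWaldspurger1995, I.2.3] -/
theorem IsKFinite.comp_of_commute
    (hrk : ∀ (g : G) (k : H.maximalCompact), r (g * ι (Subgroup.inclusion H.maximalCompact_le_carrier k)) =
      r g * ι (Subgroup.inclusion H.maximalCompact_le_carrier k))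
    {φ : G → ℂ} (hk : IsKFinite ι φ) : IsKFinite ι (φ ∘ r) := by
  unfold IsKFinite at hk ⊢
  have hle : kTranslateSpan ι (φ ∘ r) ≤ (kTranslateSpan ι φ).map (LinearMap.funLeft ℂ ℂ r) := by
    refine Submodule.span_le.2 ?_
    rintro _ ⟨k, rfl⟩
    refine ⟨archTranslate ι (Subgroup.inclusion H.maximalCompact_le_carrier k) φ,
      archTranslate_mem_kTranslateSpan ι k φ, ?_⟩
    funext g
    simp only [LinearMap.funLeft_apply, archTranslate_apply, Function.comp_apply]
    rw [hrk]
  haveI : FiniteDimensional ℂ ((kTranslateSpan ι φ).map (LinearMap.funLeft ℂ ℂ r)) := inferInstance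
  exact Submodule.finiteDimensional_of_le hle

end Finite

end Literature.NumberTheory.Automorphic
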